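import Mathlib
import Summits.Ventures.DiscreteObjects.Mahler.CensusAuxiliaryCircles
import Summits.Ventures.DiscreteObjects.Mahler.CensusAuxCircleCheck

/-!
# From two checked circle certificates to a valid auxiliary-function cut (venture `DiscreteObjects`, target L)

Cell `pub-namedobj`, seat `pub-namedobj-mahler-g15`. Framing: lottery ticket; floor = certified bounds/negative
ranges.

Assembly of the plan-B′ chain for ONE explicit-auxiliary-function cut `0 ≤ N_cut + Σ_k a_k P_k` (valid for irreducible
reciprocal `P` of degree `2d` with `M(P) < B`, `CensusAuxiliaryLog.CutValidAL`):

1. `CircleClaim (cosPoly a 2) (circleLogList1 qs) m₀` — the auxiliary function is `≥ -m₀` on `‖z‖ = 1`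
   (`auxF_ge_of_circleClaim_one`; the list of logarithmic terms on the unit circle is deduplicated, `Q(z)` and `Q(z⁻¹)`
   having the same modulus there);
2. `CircleClaim (cosPoly a (B + B⁻¹)) (circleLogList qs B) m₁` — it is `≥ -m₁` on `‖z‖ = B` (`CensusAuxCirclePoly`);
3. the maximum-modulus step `auxBoundLog_of_circles` (`CensusAuxiliaryCircles`) gives (H_log) with `c = κ/N`, provided
   `m₁ - m₀ ≤ (κ/N) log B`, checked with the certified bound `log B ≥ -logUBh B⁻¹ s₁`;
4. `2d m₀ + 2 (κ/N) log B < N_cut + 1`, checked with `log B ≤ logUBh B s₂`.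

The weights are given as naturals `n_j` over a common denominator `N` (`qsOfNs`), as the maximum-modulus step wants.  All side
conditions are one Boolean `alSideCheck` (`decide`); the two claims come from `segCheck` certificates
(`CensusAuxCircleCheck.circleClaim_of_segCheck`), possibly split into segments.  Main theorem: `cutValidAL_of_claims`.
-/

namespace Summit.Ventures.DiscreteObjects.Mahler

open Polynomial

/-! ## Weights over a common denominator -/

/-- `(v_j, n_j) ↦ (v_j, n_j / N)`. -/
def qsOfNs (ns : List (List ℤ × ℕ)) (N : ℕ) : List (List ℤ × ℚ) := ns.map fun q => (q.1, (q.2 : ℚ) / N)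

/-- Entries of `qsOfNs`. -/
theorem qsOfNs_getD {ns : List (List ℤ × ℕ)} {N : ℕ} {j : ℕ} (hj : j < ns.length) :
    (qsOfNs ns N).getD j ([], 0) = ((ns.getD j ([], 0)).1, ((ns.getD j ([], 0)).2 : ℚ) / N) := by
  unfold qsOfNs
  rw [List.getD_eq_getElem _ _ (by simpa using hj), List.getElem_map, List.getD_eq_getElem _ _ hj]

/-- Length of `qsOfNs`. -/
theorem qsOfNs_length (ns : List (List ℤ × ℕ)) (N : ℕ) : (qsOfNs ns N).length = ns.length := by
  simp [qsOfNs]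

/-! ## The unit circle with a deduplicated list of logarithmic terms -/

/-- On `‖z‖ = 1` the two factors `‖Q(z)‖²`, `‖Q(z⁻¹)‖²` coincide: one term `(G_v, e)` per vector. -/
def circleLogList1 (qs : List (List ℤ × ℚ)) : List (List ℚ × ℚ) :=
  qs.map fun q => (gPoly (q.1.map (Int.cast : ℤ → ℚ)), q.2)

/-- `scaleQ 1 = id`. -/
theorem scaleQ_one : ∀ v : List ℚ, scaleQ 1 v = v
  | [] => rfl
  | a :: v => by
    rw [scaleQ, scaleQ_one v]
    congr 1
    conv_rhs => rw [← List.map_id v]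
    exact List.map_congr_left fun b _ => by simp

/-- The full unit-circle list is the deduplicated list twice with halved weights. -/
theorem circleLogList_one (qs : List (List ℤ × ℚ)) :
    circleLogList qs 1 = (circleLogList1 qs).map (fun g => (g.1, g.2 / 2)) ++ (circleLogList1 qs).map (fun g => (g.1, g.2 / 2)) := by
  unfold circleLogList circleLogList1
  rw [inv_one, List.map_map]
  congr 1 <;> (apply List.map_congr_left; intro q _; simp [scaleQ_one])

/-- **The unit circle from the deduplicated claim:** `CircleClaim (cosPoly a 2) (circleLogList1 qs) m` implies `-m ≤ F(z)` on
`‖z‖ = 1` off the zeros of the `q̂_j`. -/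
theorem auxF_ge_of_circleClaim_one (a : List ℤ) (qs : List (List ℤ × ℚ)) {m : ℚ}
    (h : CircleClaim (cosPoly a 2) (circleLogList1 qs) m) {z : ℂ} (hz : ‖z‖ = 1)
    (hq : ∀ j < qs.length, qhat (qs.getD j ([], 0)).1 z ≠ 0) : -(m : ℝ) ≤ auxF a qs z := by
  have h' : CircleClaim (cosPoly a ((1 : ℚ) + 1⁻¹)) (circleLogList qs 1) m := by
    rw [show ((1 : ℚ) + 1⁻¹) = 2 by norm_num, circleLogList_one]
    intro w h1 h2 hpos
    have hpos' : ∀ g ∈ circleLogList1 qs, 0 < qeval g.1 w := by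
      intro g hg
      exact hpos (g.1, g.2 / 2) (List.mem_append.mpr (Or.inl (List.mem_map.mpr ⟨g, hg, rfl⟩)))
    have key := h w h1 h2 hpos'
    rw [List.map_append, List.sum_append, List.map_map, ← List.sum_map_add]
    have hsum : ((circleLogList1 qs).map fun g => ((g.2 : ℚ) : ℝ) * Real.log (qeval g.1 w)) =
        (circleLogList1 qs).map fun g => (((fun g : List ℚ × ℚ => ((g.2 : ℚ) : ℝ) * Real.log (qeval g.1 w)) ∘
          fun g => (g.1, g.2 / 2)) g + ((fun g : List ℚ × ℚ => ((g.2 : ℚ) : ℝ) * Real.log (qeval g.1 w)) ∘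
          fun g => (g.1, g.2 / 2)) g) := by
      apply List.map_congr_left; intro g _; simp only [Function.comp_apply]; push_cast; ring
    rw [← hsum]; exact key
  exact auxF_ge_of_circleClaim a qs one_pos h' (by rw [hz]; simp) hq

/-! ## Side conditions and the assembly -/

/-- The arithmetic side conditions of a two-circle certificate (all decidable over `ℚ`). -/
def alSideCheck (d : ℕ) (ns : List (List ℤ × ℕ)) (N κ : ℕ) (m0 m1 B : ℚ) (s1 s2 : ℤ) (Ncut : ℤ) : Bool :=
  decide (0 < N) && decide (1 ≤ B) &&
    ns.all (fun q => decide (0 < q.2) && decide (q.1.length ≤ 2 * d) && q.1.any (fun x => x != 0)) &&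
    decide (m1 - m0 ≤ (κ : ℚ) / N * (-(logUBh B⁻¹ s1))) &&
    decide (2 * (d : ℚ) * m0 + 2 * ((κ : ℚ) / N) * logUBh B s2 < (Ncut : ℚ) + 1)

/-- **A checked two-circle certificate yields a valid cut** `0 ≤ N_cut + Σ_k a_k P_k` for `(d, B)`
(`CutValidAL d |a| B (a.reverse, N_cut)`, table format `[a_k, …, a_1]`). -/
theorem cutValidAL_of_claims {d : ℕ} {a : List ℤ} {ns : List (List ℤ × ℕ)} {N κ : ℕ} {m0 m1 B : ℚ} {s1 s2 : ℤ}
    {Ncut : ℤ} (hside : alSideCheck d ns N κ m0 m1 B s1 s2 Ncut = true)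
    (h1 : CircleClaim (cosPoly a 2) (circleLogList1 (qsOfNs ns N)) m0)
    (h2 : CircleClaim (cosPoly a (B + B⁻¹)) (circleLogList (qsOfNs ns N) B) m1) :
    CutValidAL d a.length ((B : ℚ) : ℝ) (a.reverse, Ncut) := by
  unfold alSideCheck at hside
  simp only [Bool.and_eq_true, decide_eq_true_eq, List.all_eq_true, List.any_eq_true, bne_iff_ne, ne_eq] at hside
  obtain ⟨⟨⟨⟨hN, hB1⟩, hns⟩, hκ⟩, hcut⟩ := hside
  set qs := qsOfNs ns N with hqs
  have hB0 : (0 : ℚ) < B := lt_of_lt_of_le one_pos hB1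
  have hBr : (0 : ℝ) < (B : ℝ) := by exact_mod_cast hB0
  have hNr : (0 : ℝ) < (N : ℝ) := by exact_mod_cast hN
  have hcN : (0 : ℝ) ≤ (κ : ℝ) / N := by positivity
  -- certified bounds for `log B`
  have hlogB_lo : -(logUBh B⁻¹ s1 : ℝ) ≤ Real.log (B : ℝ) := by
    have := log_le_logUBh B⁻¹ (inv_pos.mpr hB0) s1
    push_cast at this
    rw [Real.log_inv] at this
    linarith
  have hlogB_hi : Real.log (B : ℝ) ≤ (logUBh B s2 : ℝ) := log_le_logUBh B hB0 s2
  -- the circles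
  have hc1 : ∀ z : ℂ, ‖z‖ = 1 → (∀ j < qs.length, qhat (qs.getD j ([], 0)).1 z ≠ 0) → -(m0 : ℝ) ≤ auxF a qs z :=
    fun z hz hq => auxF_ge_of_circleClaim_one a qs h1 hz hq
  have hcB : ∀ z : ℂ, ‖z‖ = (B : ℝ) → (∀ j < qs.length, qhat (qs.getD j ([], 0)).1 z ≠ 0) →
      -(m0 : ℝ) - (κ : ℝ) / N * Real.log (B : ℝ) ≤ auxF a qs z := by
    intro z hz hq
    have h := auxF_ge_of_circleClaim a qs hB0 h2 hz hq
    have hκ' : ((m1 - m0 : ℚ) : ℝ) ≤ (((κ : ℚ) / N * -logUBh B⁻¹ s1 : ℚ) : ℝ) := by exact_mod_cast hκ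
    push_cast at hκ'
    have : (κ : ℝ) / N * -(logUBh B⁻¹ s1 : ℝ) ≤ (κ : ℝ) / N * Real.log (B : ℝ) :=
      mul_le_mul_of_nonneg_left hlogB_lo hcN
    linarith
  -- weights as naturals over `N`
  have hlen : qs.length = ns.length := qsOfNs_length ns N
  have hn : ∀ j < qs.length, (((qs.getD j ([], 0)).2 : ℚ) : ℝ) = ((fun j => (ns.getD j ([], 0)).2) j : ℝ) / N := by
    intro j hj
    rw [hqs, qsOfNs_getD (by rwa [hlen] at hj)]
    push_cast; rfl
  have hmem : ∀ j < ns.length, ns.getD j ([], 0) ∈ ns := fun j hj => by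
    rw [List.getD_eq_getElem _ _ hj]; exact List.getElem_mem hj
  have hn0 : ∀ j < qs.length, 0 < (fun j => (ns.getD j ([], 0)).2) j := by
    intro j hj
    exact (hns _ (hmem j (by rwa [hlen] at hj))).1.1
  have hH : AuxBoundLog a qs (B : ℝ) m0 ((κ : ℝ) / N) := auxBoundLog_of_circles a qs hN _ hn hn0 κ hc1 hcB
  -- the cut
  refine ⟨by simp, qs, m0, (κ : ℝ) / N, hcN, ?_, ?_, by rwa [List.reverse_reverse], ?_⟩
  · intro j hj
    rw [hqs, qsOfNs_getD (by rwa [hlen] at hj)]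
    positivity
  · intro j hj
    rw [hqs, qsOfNs_getD (by rwa [hlen] at hj)]
    obtain ⟨⟨_, hl⟩, x, hx, hx0⟩ := hns _ (hmem j (by rwa [hlen] at hj))
    refine ⟨hl, ?_⟩
    obtain ⟨i, hi, rfl⟩ := List.getElem_of_mem hx
    exact ⟨i, by rwa [List.getD_eq_getElem _ _ hi]⟩
  · have hcut' : ((2 * (d : ℚ) * m0 + 2 * ((κ : ℚ) / N) * logUBh B s2 : ℚ) : ℝ) < ((Ncut + 1 : ℚ) : ℝ) := by
      exact_mod_cast hcut
    push_cast at hcut'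
    have : 2 * ((κ : ℝ) / N) * Real.log (B : ℝ) ≤ 2 * ((κ : ℝ) / N) * (logUBh B s2 : ℝ) :=
      mul_le_mul_of_nonneg_left hlogB_hi (by positivity)
    simp only
    linarith

end Summit.Ventures.DiscreteObjects.Mahler
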